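import Summits.QuantumFields.YangMills.Theorems.LuscherReductionUpperTraceDoorDefs
import Summits.QuantumFields.YangMills.Theorems.LuscherReductionUpperTraceDoorBasics
import HarnessLib

/-!
# Crux RED `RunningReduction` (stmt-QuantumFields-19978): the UPPER-HALF TT DOOR — THE SANDWICH
# `UpperTraceLaw ∧ OneSiteTail ∧ DressedRitz ⟹ CoarseNoIntruder` and the one-sided door `UpperTraceLaw ∧ DressedRitz ⟹ RunningReduction` BY NAME

Support module of the `FemtoTransferGap` group (fleet service by seat ym-infvol-p2 g7; route `LuscherReduction`, owner ym-beyond-p1, femto rung R2b1).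
RE-HOMES VERBATIM §2–§3 of the planner's kernel-checked crux workfile `Summits/QuantumFields/YangMills/Cruxes/RunningReduction/Lines/upper_trace_door.lean`
rev 3 (commit efcd23ff80e7, sha16 fb9acfdf08f96b2f; seat ym-cruxidea-19978-1 GEN 7–8; memo `…/Lines/upper_trace_door.md` rev 4 §0–§3) in namespace
`…Theorems.FemtoTransferGap.UTD` (credit: the planner's proofs, character for character, except that the ≈ 50-line lower-jaw block is now the call
`UTD.lowerJaw` of `…UpperTraceDoorBasics` and `1 − e^{−u} ≤ u` is `Real.add_one_le_exp`).  The one-sided law is the tree predicate `UTD.UpperTraceLawAt s ε`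
(`…UpperTraceDoorDefs`), quantified as `∀ s, 0 < s → ∀ ε, 0 < ε → …` (= the workfile's closed `UTD.UpperTraceLaw` by `Iff.rfl`); KT's precision-free
no-intruder law `CoarseNoIntruder` is SPELLED OUT (= the `hCO` text of the tree's `TraceDoor.runningReduction_of_coarseNoIntruder`).
LOCATED FINDING (memo §0, §3): RED consumes the XL child `TwistedTraceScaling` (stmt-QuantumFields-20203) ONLY through Lüscher's law FROM BELOW with `o(1)`
relative error; that currency follows from the ONE-SIDED, SINGLE-TIME trace law UTL by a min–max SANDWICH whose other jaw is the sibling child `DressedRitz`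
(stmt-QuantumFields-20205): trial states pin the first `k+1` levels FROM BELOW (`UTD.lowerJaw`), so a one-sided heat-trace bound cannot hide an intruder.
* §1 `coarseNoIntruder_of_upperTraceLaw : (∀ s ε …, UTD.UpperTraceLawAt s ε) → OneSiteTail → DressedRitz → ⟨CoarseNoIntruder⟩` (REAL proof) and
  `coarseNoIntruder_of_upperTraceLaw'` (child `OneSiteTail` = stmt-QuantumFields-20204 CLOSED, `OST.oneSiteTail_proof`).
* §2 ★ `runningReduction_of_upperTraceLaw : (∀ s ε …, UTD.UpperTraceLawAt s ε) → DressedRitz → Theses.LuscherReduction.RunningReduction` — RED BY NAME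
  through the landed KT composition `TraceDoor.runningReduction_of_coarseNoIntruder`; versus the route's glue (stmt-QuantumFields-20206) the two-sided dyadic
  law is replaced by its UPPER HALF at ONE femto-time per instance (converse bookkeeping: `…UpperTraceDoorConverse`).
HONEST FRAMING: implications among OPEN statements on the femto rung R2b1 (`FemtoGapOfRecord`); UTL and `DressedRitz` are XL and ASSUMED (audit:
`proof.conditional` on `hU`); no pivot of the route is executed (owner ruling (R-a), 2026-08-27); nothing here bears on infinite volume, the continuum limit
in large volume, or the Clay mass gap.  References: [cite: Luscher1983, §3]; [cite: ReedSimonIV1978, Thm. XIII.1]; [cite: Kato1949, Lemma 2].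
-/

set_option autoImplicit false

noncomputable section

open MeasureTheory Filter Topology Real
open Literature.MathematicalPhysics.QuantumFieldTheory hiding SU2
open Literature.MathematicalPhysics.QuantumLattice
open Literature.Analysis.OperatorTheory.YMMatrixModel
open scoped BigOperators

namespace Summit.QuantumFields.YangMills.Theorems.FemtoTransferGap.UTD

open Summit.QuantumFields.YangMills.Theorems.FemtoTransferGap
open Summit.QuantumFields.YangMills.Theorems.FemtoTransferGap.TT (physTrace)
open Summit.QuantumFields.YangMills.Theorems.FemtoTransferGap.TraceDoor
open Summit.QuantumFields.YangMills.Theorems.FemtoTransferGap.KTRCalibration (levelValue_antitone)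
open Summit.QuantumFields.YangMills.Theses.LuscherReduction (RunningReduction TwistedTraceScaling DressedRitz TraceFormula OneSiteTail)

/-! ## §1 The sandwich: `UpperTraceLaw ∧ OneSiteTail ∧ DressedRitz ⟹ CoarseNoIntruder`

Parameter order (given `k`, `d < Δ = Δ_k`, WLOG `d > 0`): `η₂ = (Δ−d)/4`; `OneSiteTail` at `(s₀,ε₀) = (1,1)` gives `K₀, B₁`; `N = max K₀ (k+1)`;
ONE's coarse upper law at levels `k`, `k+1` with precision `η₂` gives `B₂, B₃`; `M = 1 + (N−k)e^{3(d+3η₂)/2}`;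
`s = max 2 (log(3e^d M)/(3η₂))`; `ε = (e^{−d}/3)e^{−ds}` (UTL precision); `η = ε/(2(k+1)(s+1))` (DressedRitz precision, gives `C`);
`lam0 = min(lam_U, lam_R, 1/8, η/(2C⁺+1), 1/(4B*))`.  Deep in the window, at `T = ⌈sL/λ⌉`, `T₁ = ⌈L/(2λ)⌉`, `x = λ/L`, `τ = Tx ∈ [s, s+x]`:
`ρ^T Σ_{j<k} y_j^T + x_k^T ≤ Σ_{j≤k} x_j^T ≤ Σ_j x_j^T ≤ Σ_i y_i^T + ε` (lower bounds `x_j ≥ ρ y_j`, `ρ = e^{−(C⁺λ+η)x}`, from DressedRitz (i),(iii)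
+ RitzBasics; UTL in level currency via the closed `TraceFormula`), and `Σ_i y_i^T ≤ Σ_{j<k} y_j^T + y_k^T + (N−k−1)y_{k+1}^{T} + y_{N}^{T−T₁}·Σ_i y_{i+N}^{T₁}`
with the last tail `≤ 1` (OneSiteTail at `T₁`, shifted from `K₀` to `N`); ONE bounds `y_k ≤ e^{−(Δ−η₂)x}`, `y_{k+1} ≤ e^{−(Δ−η₂)x}`; hence
`x_k^T ≤ 2ε + M e^{−(d+3η₂)s} ≤ 3ε = e^{−d(s+1)} ≤ e^{−dτ} = (e^{−dx})^T`, i.e. `x_k ≤ e^{−dx}`. -/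

set_option maxHeartbeats 1600000 in
/-- ★ **The sandwich.**  `UpperTraceLaw ∧ OneSiteTail ∧ DressedRitz ⟹ KT.CoarseNoIntruder` (conclusion SPELLED OUT = the `hCO` text of the tree's
`TraceDoor.runningReduction_of_coarseNoIntruder`; the CLOSED children `TraceFormula`, ONE and the tree's `ritzBasicsR3` are used by name; workfile §2,
proof VERBATIM but for the `UTD.lowerJaw` call; credit ym-cruxidea-19978-1).  [cite: Luscher1983, §3] [cite: ReedSimonIV1978, Thm. XIII.1] -/
theorem coarseNoIntruder_of_upperTraceLaw (hU : ∀ s : ℝ, 0 < s → ∀ ε : ℝ, 0 < ε → UTD.UpperTraceLawAt s ε)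
    (hOST : OneSiteTail) (hDR : DressedRitz) :
    ∀ k : ℕ, ∀ d : ℝ, d < levelGap k → ∃ lam0 : ℝ, 0 < lam0 ∧ ∀ lam : ℝ, 0 < lam → lam ≤ lam0 →
      ∃ L0 : ℕ, ∀ (L : ℕ) [NeZero L], L0 ≤ L → ∀ β : ℝ, InFemtoWindow lam β L →
        levelValue su2Rep L β k ≤ Real.exp (-(d * luscherLambda β L) / L) * levelValue su2Rep L β 0 := by
  intro k d hd
  -- (0) the trivial case `d ≤ 0`
  rcases le_or_gt d 0 with hd0 | hd0
  · refine ⟨1, one_pos, fun lam hlam _ => ⟨0, fun L _ _ β hW => ?_⟩⟩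
    have hβ : (1 : ℝ) ≤ β := hW.1
    have hl : 0 < luscherLambda β L := luscherLambda_pos_of_window hlam hW
    have hL0 : (0 : ℝ) < L := Nat.cast_pos.mpr (NeZero.pos L)
    have h1 : levelValue su2Rep L β k ≤ levelValue su2Rep L β 0 := levelValue_antitone (zero_le_one.trans hβ) (Nat.zero_le k)
    have h2 : (1 : ℝ) ≤ Real.exp (-(d * luscherLambda β L) / L) := by
      apply Real.one_le_exp
      have : 0 ≤ -d * luscherLambda β L := mul_nonneg (by linarith only [hd0]) hl.le
      exact div_nonneg (by linarith only [this]) hL0.le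
    calc levelValue su2Rep L β k ≤ 1 * levelValue su2Rep L β 0 := by rw [one_mul]; exact h1
      _ ≤ _ := mul_le_mul_of_nonneg_right h2 (levelValue_zero_su2Rep_pos L β).le
  -- (1) constants fixed by `(k, d)` only
  set Δ : ℝ := levelGap k with hΔdef
  have hgap : 0 < Δ - d := sub_pos.mpr hd
  set η₂ : ℝ := (Δ - d) / 4 with hη₂def
  have hη₂ : 0 < η₂ := div_pos hgap (by norm_num)
  have hΔeq : Δ - η₂ = d + 3 * η₂ := by rw [hη₂def]; ring
  have hrate : 0 < d + 3 * η₂ := by linarith only [hd0, hη₂]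
  obtain ⟨K₀, B₁, hT1⟩ := hOST 1 one_pos 1 one_pos
  set N : ℕ := max K₀ (k + 1) with hNdef
  have hNK : K₀ ≤ N := le_max_left _ _
  have hNk : k + 1 ≤ N := le_max_right _ _
  have hNkr : (k : ℝ) + 1 ≤ N := by exact_mod_cast hNk
  obtain ⟨B₂, hB₂⟩ := oneSiteUpper_single k hη₂
  obtain ⟨B₃, hB₃⟩ := oneSiteUpper_single (k + 1) hη₂
  set Bs : ℝ := max (max B₁ B₂) (max B₃ 1) with hBsdef
  have hBs1 : 1 ≤ Bs := (le_max_right _ _).trans (le_max_right _ _)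
  have hBspos : 0 < Bs := one_pos.trans_le hBs1
  set A : ℝ := Real.exp (3 * (d + 3 * η₂) / 2) with hAdef
  have hApos : 0 < A := Real.exp_pos _
  set M : ℝ := 1 + ((N : ℝ) - k) * A with hMdef
  have hNk0 : (0 : ℝ) ≤ (N : ℝ) - k := by linarith only [hNkr]
  have hM1 : 1 ≤ M := by
    have : 0 ≤ ((N : ℝ) - k) * A := mul_nonneg hNk0 hApos.le
    linarith only [this]
  have hMpos : 0 < M := one_pos.trans_le hM1
  set s : ℝ := max 2 (Real.log (3 * Real.exp d * M) / (3 * η₂)) with hsdef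
  have hs2 : 2 ≤ s := le_max_left _ _
  have hspos : 0 < s := by linarith only [hs2]
  have hsM : M * Real.exp (-(3 * η₂ * s)) ≤ Real.exp (-d) / 3 := by
    have h1 : Real.log (3 * Real.exp d * M) / (3 * η₂) ≤ s := le_max_right _ _
    have h2 : Real.log (3 * Real.exp d * M) ≤ 3 * η₂ * s := by
      rw [div_le_iff₀ (by positivity)] at h1; linarith only [h1]
    have h3 : 3 * Real.exp d * M ≤ Real.exp (3 * η₂ * s) := by
      have := Real.exp_le_exp.mpr h2
      rwa [Real.exp_log (by positivity)] at this
    have hE : 0 < Real.exp (3 * η₂ * s) := Real.exp_pos _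
    have hdd : Real.exp (-d) * Real.exp d = 1 := by rw [← Real.exp_add, neg_add_cancel, Real.exp_zero]
    rw [Real.exp_neg (3 * η₂ * s)]
    rw [mul_inv_le_iff₀ hE]
    -- `M ≤ e^{-d}/3 · e^{3η₂ s}`
    calc M = Real.exp (-d) / 3 * (3 * Real.exp d * M) := by
          rw [show Real.exp (-d) / 3 * (3 * Real.exp d * M) = (Real.exp (-d) * Real.exp d) * M by ring, hdd, one_mul]
      _ ≤ Real.exp (-d) / 3 * Real.exp (3 * η₂ * s) := mul_le_mul_of_nonneg_left h3 (by positivity)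
  set ε : ℝ := Real.exp (-d) / 3 * Real.exp (-(d * s)) with hεdef
  have hε : 0 < ε := mul_pos (div_pos (Real.exp_pos _) (by norm_num)) (Real.exp_pos _)
  set η : ℝ := ε / (2 * ((k : ℝ) + 1) * (s + 1)) with hηdef
  have hden : 0 < 2 * ((k : ℝ) + 1) * (s + 1) := by positivity
  have hη : 0 < η := div_pos hε hden
  obtain ⟨lamU, hlamU, hUs⟩ := hU s hspos ε hε
  obtain ⟨C, lamR, hlamR, hR⟩ := hDR k η hη
  set C1 : ℝ := max C 0 with hC1def
  have hC10 : 0 ≤ C1 := le_max_right _ _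
  have hCC1 : C ≤ C1 := le_max_left _ _
  have h2C1 : 0 < 2 * C1 + 1 := by linarith only [hC10]
  have hq1 : 0 < η / (2 * C1 + 1) := div_pos hη h2C1
  have hq2 : 0 < 1 / (4 * Bs) := by positivity
  refine ⟨min (min lamU lamR) (min (1 / 8) (min (η / (2 * C1 + 1)) (1 / (4 * Bs)))),
    lt_min (lt_min hlamU hlamR) (lt_min (by norm_num) (lt_min hq1 hq2)), fun lam hlam hlamle => ?_⟩
  have hlamU' : lam ≤ lamU := hlamle.trans ((min_le_left _ _).trans (min_le_left _ _))
  have hlamR' : lam ≤ lamR := hlamle.trans ((min_le_left _ _).trans (min_le_right _ _))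
  have hlam8 : lam ≤ 1 / 8 := hlamle.trans ((min_le_right _ _).trans (min_le_left _ _))
  have hlamη : lam ≤ η / (2 * C1 + 1) :=
    hlamle.trans ((min_le_right _ _).trans ((min_le_right _ _).trans (min_le_left _ _)))
  have hlamB : lam ≤ 1 / (4 * Bs) :=
    hlamle.trans ((min_le_right _ _).trans ((min_le_right _ _).trans (min_le_right _ _)))
  obtain ⟨L0U, hL0U⟩ := hUs lam hlam hlamU'
  obtain ⟨L0R, hL0R⟩ := hR lam hlam hlamR'
  refine ⟨max L0U L0R, fun L _ hL β hW => ?_⟩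
  have hLU : L0U ≤ L := (le_max_left _ _).trans hL
  have hLR : L0R ≤ L := (le_max_right _ _).trans hL
  -- the two eventual hypotheses at this `(L, β)`
  have hUTL := hL0U L hLU β hW
  obtain ⟨φ, hφphys, hφon, hφdiag, hφanti, hratio, -, hcap⟩ := hL0R L hLR β hW
  have hB14 : 1 / (4 * lam ^ 3) ≤ oneSiteCoupling β L := oneSiteCoupling_ge_of_window hlam hW
  obtain ⟨hβ, hlamle', hlam2⟩ := hW
  have hβ0 : (0 : ℝ) ≤ β := zero_le_one.trans hβ
  -- scales
  set l : ℝ := luscherLambda β L with hldef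
  have hlpos : 0 < l := hlam.trans_le hlamle'
  have hLpos : (0 : ℝ) < L := Nat.cast_pos.mpr (NeZero.pos L)
  have hL1 : (1 : ℝ) ≤ L := by exact_mod_cast NeZero.one_le
  set x : ℝ := l / L with hxdef
  have hxpos : 0 < x := div_pos hlpos hLpos
  have hxl : x ≤ l := div_le_self hlpos.le hL1
  have hl14 : l ≤ 1 / 4 := by linarith only [hlam2, hlam8]
  have hx1 : x ≤ 1 := by linarith only [hxl, hl14]
  have hlx : 0 < l * x := mul_pos hlpos hxpos
  -- the one-site coupling is beyond every threshold
  set B : ℝ := oneSiteCoupling β L with hBdef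
  have hBge : Bs ≤ B := by
    have hlam1 : lam ≤ 1 := by linarith only [hlam8]
    have h3 : lam ^ 3 ≤ lam := by
      have := pow_le_pow_of_le_one hlam.le hlam1 (show 1 ≤ 3 by norm_num)
      rwa [pow_one] at this
    have h4 : lam * (4 * Bs) ≤ 1 := by rwa [le_div_iff₀ (by positivity)] at hlamB
    have h5 : Bs ≤ 1 / (4 * lam ^ 3) := by
      rw [le_div_iff₀ (by positivity)]
      calc Bs * (4 * lam ^ 3) = (4 * Bs) * lam ^ 3 := by ring
        _ ≤ (4 * Bs) * lam := mul_le_mul_of_nonneg_left h3 (by positivity)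
        _ = lam * (4 * Bs) := by ring
        _ ≤ 1 := h4
    exact h5.trans hB14
  have hB1' : B₁ ≤ B := ((le_max_left _ _).trans (le_max_left _ _)).trans hBge
  have hB2' : B₂ ≤ B := ((le_max_right _ _).trans (le_max_left _ _)).trans hBge
  have hB3' : B₃ ≤ B := ((le_max_left _ _).trans (le_max_right _ _)).trans hBge
  have hB1 : 1 ≤ B := hBs1.trans hBge
  have hbl : bareLambda B = x := by rw [hBdef, hxdef, hldef]; exact bareLambda_oneSiteCoupling hlpos
  have hmu0 : 0 < levelValue su2Rep 1 B 0 := levelValue_zero_su2Rep_pos 1 B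
  have hl0 : 0 < levelValue su2Rep L β 0 := levelValue_zero_su2Rep_pos L β
  have hmunn : ∀ i : ℕ, 0 ≤ levelValue su2Rep 1 B i := fun i => transferValuesNonneg 1 B i hB1
  -- times
  set T : ℕ := femtoSteps s β L with hTdef
  set T₁ : ℕ := femtoSteps (1 / 2) β L with hT₁def
  obtain ⟨hτlo0, hτhi0⟩ := femtoSteps_mul_bounds (s := s) (β := β) (L := L) hspos.le hlpos
  obtain ⟨hτ₁lo0, hτ₁hi0⟩ := femtoSteps_mul_bounds (s := 1 / 2) (β := β) (L := L) (by norm_num) hlpos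
  have hτlo : s ≤ (T : ℝ) * x := hτlo0
  have hτhi : (T : ℝ) * x ≤ s + x := hτhi0
  have hτ₁lo : 1 / 2 ≤ (T₁ : ℝ) * x := hτ₁lo0
  have hτ₁hi : (T₁ : ℝ) * x ≤ 1 / 2 + x := hτ₁hi0
  have hT₁T : T₁ ≤ T := femtoSteps_mono (by linarith only [hs2]) hlpos.le
  have hTx : (T : ℝ) * x ≤ T := (mul_le_mul_of_nonneg_left hx1 (Nat.cast_nonneg T)).trans_eq (mul_one _)
  have hT2r : (2 : ℝ) ≤ T := by linarith only [hs2, hτlo, hTx]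
  have hT2 : 2 ≤ T := by exact_mod_cast hT2r
  have hTpos : 0 < T := by omega
  have hτ1 : (T : ℝ) * x ≤ s + 1 := by linarith only [hτhi, hx1]
  have hsub : (((T - T₁ : ℕ) : ℝ)) = (T : ℝ) - T₁ := Nat.cast_sub hT₁T
  have hτdiff : s - 3 / 2 ≤ ((T - T₁ : ℕ) : ℝ) * x := by
    rw [hsub]; linarith only [hτlo, hτ₁hi, hx1]
  -- the trace laws in level currency (closed `TraceFormula`)
  have hHS := hasSum_xval_pow (L := L) (β := β) hβ hT2
  have hHS1 := hasSum_xval_pow (L := 1) (β := B) hB1 hT2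
  -- normalised levels
  set y : ℕ → ℝ := xval 1 B with hydef
  set z : ℕ → ℝ := xval L β with hzdef
  have hy0 : ∀ i, 0 ≤ y i := fun i => xval_nonneg hB1 i
  have hy1 : ∀ i, y i ≤ 1 := fun i => xval_le_one hB1 i
  have hymono : ∀ {i j : ℕ}, i ≤ j → y j ≤ y i := fun hij => xval_le_xval hB1 hij
  have hz0 : ∀ j, 0 ≤ z j := fun j => xval_nonneg hβ j
  -- OneSiteTail at `T₁` and at `T`
  have hadm₁ : (1 : ℝ) ≤ 2 * ((T₁ : ℝ) * bareLambda B) := by rw [hbl]; linarith only [hτ₁lo]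
  have hadm : (1 : ℝ) ≤ 2 * ((T : ℝ) * bareLambda B) := by rw [hbl]; linarith only [hτlo, hs2]
  obtain ⟨hsumT₁, htailT₁⟩ := hT1 B hB1' T₁ hadm₁
  obtain ⟨hsumT, -⟩ := hT1 B hB1' T hadm
  have hsumT₁' : Summable (fun i => y i ^ T₁) := hsumT₁
  have hsumT' : Summable (fun i => y i ^ T) := hsumT
  have htailT₁' : ∑' i, y (i + K₀) ^ T₁ ≤ 1 := htailT₁
  have hsumz : Summable (fun j => z j ^ T) := hHS.summable
  have hUTL' : ∑' j, z j ^ T ≤ ∑' i, y i ^ T + ε := by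
    rw [hHS.tsum_eq, hHS1.tsum_eq, div_le_iff₀ (pow_pos hl0 T)]
    exact hUTL
  -- the dressed Ritz family: lower bounds `ρ y_j ≤ x_j` for `j ≤ k` (`UTD.lowerJaw`: top capture + Rayleigh–Ritz + Lüscher position)
  set ρ : ℝ := Real.exp (-((C1 * l + η) * x)) with hρdef
  have hρpos : 0 < ρ := Real.exp_pos _
  have hClη : 0 ≤ (C1 * l + η) * x := by positivity
  have hρ1 : ρ ≤ 1 := by
    rw [hρdef]; exact Real.exp_le_one_iff.mpr (by linarith only [hClη])
  have hlow : ∀ j : ℕ, j ≤ k → ρ * y j ≤ z j :=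
    lowerJaw hβ hB1 hlpos hCC1 φ hφphys hφon hφdiag hφanti hratio hcap
  -- (2) the counting
  have hfin_z : ∑ j ∈ Finset.range (k + 1), z j ^ T ≤ ∑' j, z j ^ T :=
    hsumz.sum_le_tsum (Finset.range (k + 1)) (fun j _ => pow_nonneg (hz0 j) T)
  have hxlow : ρ ^ T * ∑ j ∈ Finset.range k, y j ^ T + z k ^ T ≤ ∑ j ∈ Finset.range (k + 1), z j ^ T := by
    rw [Finset.sum_range_succ, Finset.mul_sum]
    refine add_le_add ?_ le_rfl
    apply Finset.sum_le_sum
    intro j hj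
    have hjk : j ≤ k := (Finset.mem_range.mp hj).le
    have := pow_le_pow_left₀ (mul_nonneg hρpos.le (hy0 j)) (hlow j hjk) T
    rwa [mul_pow] at this
  have hsplit_y : ∑' i, y i ^ T = ∑ i ∈ Finset.range N, y i ^ T + ∑' i, y (i + N) ^ T :=
    (hsumT'.sum_add_tsum_nat_add N).symm
  have hsplit_y2 : ∑ i ∈ Finset.range N, y i ^ T =
      (∑ i ∈ Finset.range k, y i ^ T + y k ^ T) + ∑ i ∈ Finset.Ico (k + 1) N, y i ^ T := by
    rw [← Finset.sum_range_succ, Finset.sum_range_add_sum_Ico _ hNk]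
  have hmid : ∑ i ∈ Finset.Ico (k + 1) N, y i ^ T ≤ ((N : ℝ) - (k + 1)) * y (k + 1) ^ (T - T₁) := by
    have h1 : ∀ i ∈ Finset.Ico (k + 1) N, y i ^ T ≤ y (k + 1) ^ (T - T₁) := by
      intro i hi
      have hik : k + 1 ≤ i := (Finset.mem_Ico.mp hi).1
      calc y i ^ T ≤ y (k + 1) ^ T := pow_le_pow_left₀ (hy0 i) (hymono hik) T
        _ ≤ y (k + 1) ^ (T - T₁) := pow_le_pow_of_le_one (hy0 _) (hy1 _) (Nat.sub_le T T₁)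
    calc ∑ i ∈ Finset.Ico (k + 1) N, y i ^ T ≤ ∑ i ∈ Finset.Ico (k + 1) N, y (k + 1) ^ (T - T₁) := Finset.sum_le_sum h1
      _ = ((N : ℝ) - (k + 1)) * y (k + 1) ^ (T - T₁) := by
        rw [Finset.sum_const, Nat.card_Ico, nsmul_eq_mul, Nat.cast_sub hNk]; push_cast; ring
  have htail : ∑' i, y (i + N) ^ T ≤ y (k + 1) ^ (T - T₁) := by
    have hsumN₁ : Summable (fun i => y (i + N) ^ T₁) := (summable_nat_add_iff N).2 hsumT₁'
    have hle1 : ∑' i, y (i + N) ^ T₁ ≤ 1 := by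
      obtain ⟨dd, hdd⟩ := Nat.exists_eq_add_of_le hNK
      have h := OST.tsum_shift_le (f := fun i => y i ^ T₁) hsumT₁' (fun i => pow_nonneg (hy0 i) _) K₀ dd
      rw [← hdd] at h
      exact h.trans htailT₁'
    have hterm : ∀ i, y (i + N) ^ T ≤ y (i + N) ^ T₁ * y (k + 1) ^ (T - T₁) := by
      intro i
      have e : T₁ + (T - T₁) = T := Nat.add_sub_cancel' hT₁T
      calc y (i + N) ^ T = y (i + N) ^ T₁ * y (i + N) ^ (T - T₁) := by rw [← pow_add, e]
        _ ≤ y (i + N) ^ T₁ * y (k + 1) ^ (T - T₁) :=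
            mul_le_mul_of_nonneg_left (pow_le_pow_left₀ (hy0 _) (hymono (by omega)) _) (pow_nonneg (hy0 _) _)
    have hsumN : Summable (fun i => y (i + N) ^ T) := (summable_nat_add_iff N).2 hsumT'
    calc ∑' i, y (i + N) ^ T ≤ ∑' i, y (i + N) ^ T₁ * y (k + 1) ^ (T - T₁) := hsumN.tsum_le_tsum hterm (hsumN₁.mul_right _)
      _ = (∑' i, y (i + N) ^ T₁) * y (k + 1) ^ (T - T₁) := tsum_mul_right
      _ ≤ 1 * y (k + 1) ^ (T - T₁) := mul_le_mul_of_nonneg_right hle1 (pow_nonneg (hy0 _) _)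
      _ = y (k + 1) ^ (T - T₁) := one_mul _
  -- (3) the pointwise bounds
  set E : ℝ := Real.exp (-((d + 3 * η₂) * s)) with hEdef
  have hyk : y k ^ T ≤ E := by
    obtain ⟨-, hk⟩ := hB₂ B hB2'
    have h1 : y k ≤ Real.exp (-((Δ - η₂) * x)) := by
      show levelValue su2Rep 1 B k / levelValue su2Rep 1 B 0 ≤ _
      rw [div_le_iff₀ hmu0, ← hbl]; exact hk
    have h2 : (d + 3 * η₂) * s ≤ (d + 3 * η₂) * ((T : ℝ) * x) := mul_le_mul_of_nonneg_left hτlo hrate.le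
    calc y k ^ T ≤ Real.exp (-((Δ - η₂) * x)) ^ T := pow_le_pow_left₀ (hy0 k) h1 T
      _ = Real.exp (-((d + 3 * η₂) * ((T : ℝ) * x))) := by rw [← Real.exp_nat_mul, hΔeq]; congr 1; ring
      _ ≤ E := Real.exp_le_exp.mpr (by linarith only [h2])
  have hyk1 : y (k + 1) ^ (T - T₁) ≤ A * E := by
    obtain ⟨-, hk⟩ := hB₃ B hB3'
    have hgapmono : Δ ≤ levelGap (k + 1) := levelGap_mono (Nat.le_succ k)
    have h0 : (Δ - η₂) * x ≤ (levelGap (k + 1) - η₂) * x := mul_le_mul_of_nonneg_right (by linarith only [hgapmono]) hxpos.le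
    have h1 : y (k + 1) ≤ Real.exp (-((Δ - η₂) * x)) := by
      show levelValue su2Rep 1 B (k + 1) / levelValue su2Rep 1 B 0 ≤ _
      rw [div_le_iff₀ hmu0]
      calc levelValue su2Rep 1 B (k + 1) ≤ Real.exp (-((levelGap (k + 1) - η₂) * bareLambda B)) * levelValue su2Rep 1 B 0 := hk
        _ ≤ Real.exp (-((Δ - η₂) * x)) * levelValue su2Rep 1 B 0 := by
            apply mul_le_mul_of_nonneg_right _ hmu0.le
            rw [hbl]; exact Real.exp_le_exp.mpr (by linarith only [h0])
    have h2 : (d + 3 * η₂) * (s - 3 / 2) ≤ (d + 3 * η₂) * (((T - T₁ : ℕ) : ℝ) * x) := mul_le_mul_of_nonneg_left hτdiff hrate.le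
    calc y (k + 1) ^ (T - T₁) ≤ Real.exp (-((Δ - η₂) * x)) ^ (T - T₁) := pow_le_pow_left₀ (hy0 _) h1 _
      _ = Real.exp (-((d + 3 * η₂) * (((T - T₁ : ℕ) : ℝ) * x))) := by rw [← Real.exp_nat_mul, hΔeq]; congr 1; ring
      _ ≤ Real.exp (-((d + 3 * η₂) * (s - 3 / 2))) := Real.exp_le_exp.mpr (by linarith only [h2])
      _ = A * E := by rw [hAdef, hEdef, ← Real.exp_add]; congr 1; ring
  have hsmall : (1 - ρ ^ T) * ∑ j ∈ Finset.range k, y j ^ T ≤ ε := by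
    have hcard : ∑ j ∈ Finset.range k, y j ^ T ≤ k := by
      calc ∑ j ∈ Finset.range k, y j ^ T ≤ ∑ j ∈ Finset.range k, (1 : ℝ) :=
            Finset.sum_le_sum fun j _ => pow_le_one₀ (hy0 j) (hy1 j)
        _ = k := by simp
    have hρT : 1 - ρ ^ T ≤ (C1 * l + η) * ((T : ℝ) * x) := by
      have e : ρ ^ T = Real.exp (-((C1 * l + η) * ((T : ℝ) * x))) := by
        rw [hρdef, ← Real.exp_nat_mul]; congr 1; ring
      rw [e]; linarith only [Real.add_one_le_exp (-((C1 * l + η) * ((T : ℝ) * x)))]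
    have hCl : C1 * l ≤ η := by
      have h3 : 2 * C1 / (2 * C1 + 1) ≤ 1 := by rw [div_le_one h2C1]; linarith only [hC10]
      calc C1 * l ≤ C1 * (2 * (η / (2 * C1 + 1))) := mul_le_mul_of_nonneg_left (by linarith only [hlam2, hlamη]) hC10
        _ = η * (2 * C1 / (2 * C1 + 1)) := by ring
        _ ≤ η * 1 := mul_le_mul_of_nonneg_left h3 hη.le
        _ = η := mul_one η
    have h1ρ : 0 ≤ 1 - ρ ^ T := by
      have := pow_le_one₀ hρpos.le hρ1 (n := T); linarith only [this]
    have h2η : C1 * l + η ≤ 2 * η := by linarith only [hCl]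
    calc (1 - ρ ^ T) * ∑ j ∈ Finset.range k, y j ^ T ≤ ((C1 * l + η) * ((T : ℝ) * x)) * k :=
          mul_le_mul hρT hcard (Finset.sum_nonneg fun j _ => pow_nonneg (hy0 j) T) (by positivity)
      _ ≤ (2 * η * (s + 1)) * k := by
          apply mul_le_mul_of_nonneg_right _ (Nat.cast_nonneg k)
          exact mul_le_mul h2η hτ1 (by positivity) (by positivity)
      _ = ε * (k / ((k : ℝ) + 1)) := by rw [hηdef]; field_simp
      _ ≤ ε * 1 := by
          apply mul_le_mul_of_nonneg_left _ hε.le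
          rw [div_le_one (by positivity)]; linarith only []
      _ = ε := mul_one ε
  -- (4) assembly: `x_k^T ≤ 3ε = e^{−d(s+1)} ≤ (e^{−dx})^T`
  have hzk : z k ^ T ≤ Real.exp (-(d * x)) ^ T := by
    have h0 := calc ρ ^ T * ∑ j ∈ Finset.range k, y j ^ T + z k ^ T ≤ ∑' j, z j ^ T := hxlow.trans hfin_z
        _ ≤ ∑' i, y i ^ T + ε := hUTL'
        _ = (∑ i ∈ Finset.range k, y i ^ T + y k ^ T) + ∑ i ∈ Finset.Ico (k + 1) N, y i ^ T + ∑' i, y (i + N) ^ T + ε := by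
            rw [hsplit_y, hsplit_y2]
    have h1 : z k ^ T ≤ (1 - ρ ^ T) * ∑ j ∈ Finset.range k, y j ^ T + y k ^ T +
        ((N : ℝ) - (k + 1)) * y (k + 1) ^ (T - T₁) + y (k + 1) ^ (T - T₁) + ε := by
      linarith only [h0, hmid, htail]
    have h4' : ((N : ℝ) - k) * y (k + 1) ^ (T - T₁) ≤ ((N : ℝ) - k) * (A * E) := mul_le_mul_of_nonneg_left hyk1 hNk0
    have h2 : y k ^ T + ((N : ℝ) - (k + 1)) * y (k + 1) ^ (T - T₁) + y (k + 1) ^ (T - T₁) ≤ M * E := by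
      have e : M * E = E + ((N : ℝ) - k) * (A * E) := by rw [hMdef]; ring
      rw [e]; linarith only [h4', hyk]
    have h3 : M * E ≤ ε := by
      have e : E = Real.exp (-(3 * η₂ * s)) * Real.exp (-(d * s)) := by
        rw [hEdef, ← Real.exp_add]; congr 1; ring
      rw [e, ← mul_assoc, hεdef]
      exact mul_le_mul_of_nonneg_right hsM (Real.exp_pos _).le
    have h4 : z k ^ T ≤ 3 * ε := by linarith only [h1, hsmall, h2, h3]
    have h5 : 3 * ε = Real.exp (-(d * (s + 1))) := by
      rw [hεdef, show -(d * (s + 1)) = -d + -(d * s) by ring, Real.exp_add]; ring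
    have h6' : d * ((T : ℝ) * x) ≤ d * (s + 1) := mul_le_mul_of_nonneg_left hτ1 hd0.le
    have h6 : Real.exp (-(d * (s + 1))) ≤ Real.exp (-(d * ((T : ℝ) * x))) :=
      Real.exp_le_exp.mpr (by linarith only [h6'])
    have h7 : Real.exp (-(d * ((T : ℝ) * x))) = Real.exp (-(d * x)) ^ T := by
      rw [← Real.exp_nat_mul]; congr 1; ring
    exact h4.trans (h5.le.trans (h6.trans h7.le))
  have hzk' : z k ≤ Real.exp (-(d * x)) := (pow_le_pow_iff_left₀ (hz0 k) (Real.exp_pos _).le hTpos.ne').mp hzk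
  -- (5) back to the statement
  have e_goal : -(d * l) / (L : ℝ) = -(d * x) := by rw [hxdef]; ring
  rw [e_goal]
  have hfin : levelValue su2Rep L β k / levelValue su2Rep L β 0 ≤ Real.exp (-(d * x)) := hzk'
  rwa [div_le_iff₀ hl0] at hfin

/-! ## §2 Conclusion: `UpperTraceLaw ∧ DressedRitz ⟹ RED` BY NAME (children `TraceFormula`, `OneSiteTail` CLOSED in the tree; KT composition landed) -/

/-- The sandwich with the CLOSED child `OneSiteTail` (stmt-QuantumFields-20204, `OST.oneSiteTail_proof`, p516856) discharged by name (workfile §3).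
[cite: Luscher1983, §3] -/
theorem coarseNoIntruder_of_upperTraceLaw' (hU : ∀ s : ℝ, 0 < s → ∀ ε : ℝ, 0 < ε → UTD.UpperTraceLawAt s ε) (hDR : DressedRitz) :
    ∀ k : ℕ, ∀ d : ℝ, d < levelGap k → ∃ lam0 : ℝ, 0 < lam0 ∧ ∀ lam : ℝ, 0 < lam → lam ≤ lam0 →
      ∃ L0 : ℕ, ∀ (L : ℕ) [NeZero L], L0 ≤ L → ∀ β : ℝ, InFemtoWindow lam β L →
        levelValue su2Rep L β k ≤ Real.exp (-(d * luscherLambda β L) / L) * levelValue su2Rep L β 0 :=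
  coarseNoIntruder_of_upperTraceLaw hU OST.oneSiteTail_proof hDR

/-- ★★ **ONE-SIDED TT DOOR** (workfile §3).  `UpperTraceLaw → DressedRitz → Theses.LuscherReduction.RunningReduction` — the crux RED (stmt-QuantumFields-19978)
BY NAME from the ONE-SIDED trace law (`∀ s ε, UTD.UpperTraceLawAt s ε`) and the route child `DressedRitz` (stmt-QuantumFields-20205) alone: the sandwich (§1)
feeds the landed KT composition `TraceDoor.runningReduction_of_coarseNoIntruder`.  Versus the route's glue item `TraceDoorGlue` (stmt-QuantumFields-20206)
`TraceFormula → TwistedTraceScaling → OneSiteTail → DressedRitz → RunningReduction`, the two-sided dyadic law (XL child 20203) is replaced by its upper half at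
a single femto-time.  CONDITIONAL on both hypotheses (OPEN, XL); credit ym-cruxidea-19978-1. [cite: Luscher1983, §3] [cite: Kato1949, Lemma 2] -/
theorem runningReduction_of_upperTraceLaw (hU : ∀ s : ℝ, 0 < s → ∀ ε : ℝ, 0 < ε → UTD.UpperTraceLawAt s ε) (hDR : DressedRitz) :
    Summit.QuantumFields.YangMills.Theses.LuscherReduction.RunningReduction :=
  TraceDoor.runningReduction_of_coarseNoIntruder (coarseNoIntruder_of_upperTraceLaw' hU hDR) hDR

end Summit.QuantumFields.YangMills.Theorems.FemtoTransferGap.UTD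

end
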